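import Summits.AtomisticToContinuum.Crystallization.Theorems.FreeSplittingCertificatesRadiusLadderCompactness

/-!
# Radius ladder for `FiniteRangeSplitting`: the rung region is closed in the RADIUS too — the minimal rung
# radius `R*(δ)` is attained, `δ*` is right-continuous, and `R*` jumps from `0` to `≥ δ` at `δ_½`

Route `FreeSplittingCertificates`, crux r2 `FiniteRangeSplitting` (stmt-AtomisticToContinuum-12559); block-2b unit
`b2b-freesplit`, PART A gen 14.  Value = structural theorems about the crux — NOT summit progress.

`…RadiusLadderCompactness` closed the rung region `{(δ, R) | RungAt δ R}` from above in `ε` and in `δ` at fixed radius.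
Dilating the RADIUS with the hard core closes it from above in `R` as well: from `RungAt δ R'` for all `R' > R > 0`,
monotonicity in `δ` gives `RungAt (cδ) (cR)`, the dilation of `…RadiusLadderScaling` gives `ARungAt δ η R` with
`η = 250 (c - 1) δ⁻⁶ → 0`, and compactness gives `RungAt δ R` (`rungAt_of_forall_gt_radius`).  Consequences:

* the minimal rung radius `R*(δ) := radThreshold δ = inf {R > 0 | RungAt δ R}` of a hard core `δ ∈ RungSet` is
  ATTAINED when positive, and `RungAt δ R ↔ R*(δ) ≤ R` for `R > 0` (`rungAt_iff_radThreshold_le`); `R*` is antitone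
  on `RungSet`;
* `R*(δ) = 0` for `δ ≥ δ_½` (`radThreshold_eq_zero_of_threshold_le`) but `R*(δ) ≥ δ` for `δ ∈ RungSet`, `δ < δ_½`
  (`le_radThreshold_of_lt_threshold`) and `R*(δ) ≥ 47/50` for `δ ≤ 47/50` (`radThreshold_ge_47_50`): at the
  half-rule threshold the minimal radius JUMPS from `0` to at least `δ_½ ≥ 47/50`;
* `δ*` is right-continuous on `(0, ∞)`: `IsLUB (δ* '' Ioi R) (δ*(R))` (`isLUB_sepThreshold_Ioi`,
  `tendsto_sepThreshold_nhdsGT`); so is `R*` on `RungSet` (`isLUB_radThreshold_Ioi`);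
* the duality `δ*(R) ≤ δ ↔ RungAt δ R ↔ R*(δ) ≤ R` (`sepThreshold_le_iff_radThreshold_le`).
-/

noncomputable section

namespace Summit.AtomisticToContinuum.Crystallization.Theorems.StrictSplittingRuleBirth

open scoped BigOperators Classical Topology
open Filter Literature.MathematicalPhysics.StatisticalMechanics

/-! ## 1. Closed from above in the radius -/

/-- **Closedness in `R` (`ε`-version)**: if `ARungAt δ ε R'` for every `R' > R > 0` (`δ > 0`), then `ARungAt δ ε R`
(dilate hard core AND radius by `c ↓ 1`, then compactness in `ε`). -/
theorem arungAt_of_forall_gt_radius {δ ε R : ℝ} (hδ : 0 < δ) (hR : 0 < R)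
    (h : ∀ R' : ℝ, R < R' → ARungAt δ ε R') : ARungAt δ ε R := by
  refine arungAt_of_forall_gt_eps fun η hη => ?_
  set c : ℝ := 1 + η * δ ^ 6 / 250 with hc_def
  have hpos : 0 < η * δ ^ 6 / 250 := by positivity
  have hc1 : 1 < c := by rw [hc_def]; linarith
  have hc0 : 0 < c := one_pos.trans hc1
  have h1 : ARungAt (c * δ) ε (c * R) :=
    arungAt_mono_sep (le_mul_of_one_le_left hδ.le hc1.le) (h (c * R) (lt_mul_of_one_lt_left hR hc1))
  have key := arungAt_of_arungAt_mul hδ hc1.le h1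
  have hc' : c - 1 = η * δ ^ 6 / 250 := by rw [hc_def]; ring
  have hcR : c * R / c = R := by field_simp
  rw [hc', dilation_price hδ.ne', hcR] at key
  exact key

/-- **Closedness in `R`**: if `RungAt δ R'` for every `R' > R > 0` (`δ > 0`), then `RungAt δ R`. -/
theorem rungAt_of_forall_gt_radius {δ R : ℝ} (hδ : 0 < δ) (hR : 0 < R)
    (h : ∀ R' : ℝ, R < R' → RungAt δ R') : RungAt δ R := by
  rw [← arungAt_zero_iff]
  exact arungAt_of_forall_gt_radius hδ hR fun R' hR' => (arungAt_zero_iff δ R').2 (h R' hR')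

/-! ## 2. The minimal rung radius `R*(δ)` -/

/-- The positive radii at which the hard core `δ` carries a rung. [folklore] -/
def RadSetAt (δ : ℝ) : Set ℝ := {R : ℝ | 0 < R ∧ RungAt δ R}

/-- `RadSetAt δ` is an up-set. -/
theorem mem_radSetAt_of_le {δ R R' : ℝ} (h : R ∈ RadSetAt δ) (hle : R ≤ R') : R' ∈ RadSetAt δ :=
  ⟨h.1.trans_le hle, rungAt_mono_radius hle h.2⟩

/-- `RadSetAt` grows with the hard core. -/
theorem radSetAt_mono {δ δ' : ℝ} (h : δ ≤ δ') : RadSetAt δ ⊆ RadSetAt δ' :=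
  fun _ hR => ⟨hR.1, rungAt_mono_sep h hR.2⟩

/-- `RadSetAt δ` is bounded below by `0`. -/
theorem radSetAt_bddBelow (δ : ℝ) : BddBelow (RadSetAt δ) :=
  ⟨0, fun _ h => h.1.le⟩

/-- For `δ > 0`: `RadSetAt δ` is nonempty iff `δ ∈ RungSet`. -/
theorem radSetAt_nonempty_iff {δ : ℝ} (hδ : 0 < δ) : (RadSetAt δ).Nonempty ↔ δ ∈ RungSet :=
  ⟨fun ⟨R, hR, hr⟩ => ⟨hδ, R, hR, hr⟩, fun ⟨_, R, hR, hr⟩ => ⟨R, hR, hr⟩⟩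

/-- **`RadSetAt δ` is closed from above** (`δ > 0`). -/
theorem mem_radSetAt_of_forall_gt {δ R : ℝ} (hδ : 0 < δ) (hR : 0 < R)
    (h : ∀ R' : ℝ, R < R' → R' ∈ RadSetAt δ) : R ∈ RadSetAt δ :=
  ⟨hR, rungAt_of_forall_gt_radius hδ hR fun R' hR' => (h R' hR').2⟩

/-- The minimal rung radius of the hard core `δ`: `R*(δ) := inf {R > 0 | RungAt δ R}` (meaningful for
`δ ∈ RungSet`; the junk value `0` otherwise). [folklore] -/
def radThreshold (δ : ℝ) : ℝ := sInf (RadSetAt δ)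

/-- `0 ≤ R*(δ)`. -/
theorem radThreshold_nonneg (δ : ℝ) : 0 ≤ radThreshold δ := by
  by_cases h : (RadSetAt δ).Nonempty
  · exact le_csInf h fun _ hR => hR.1.le
  · rw [Set.not_nonempty_iff_eq_empty] at h
    simp [radThreshold, h]

/-- `R*(δ) ≤ R` for `R ∈ RadSetAt δ`. -/
theorem radThreshold_le_of_mem {δ R : ℝ} (h : R ∈ RadSetAt δ) : radThreshold δ ≤ R :=
  csInf_le (radSetAt_bddBelow δ) h

/-- Every radius strictly above `R*(δ)` carries a rung (`δ ∈ RungSet`). -/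
theorem mem_radSetAt_of_radThreshold_lt {δ R : ℝ} (hδ : 0 < δ) (hmem : δ ∈ RungSet)
    (h : radThreshold δ < R) : R ∈ RadSetAt δ := by
  obtain ⟨s, hs, hsR⟩ := (csInf_lt_iff (radSetAt_bddBelow δ) ((radSetAt_nonempty_iff hδ).2 hmem)).mp h
  exact mem_radSetAt_of_le hs hsR.le

/-- **Attainment**: a positive `R*(δ)` (`δ ∈ RungSet`) carries a rung itself. -/
theorem radThreshold_mem {δ : ℝ} (hδ : 0 < δ) (hmem : δ ∈ RungSet) (hpos : 0 < radThreshold δ) :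
    radThreshold δ ∈ RadSetAt δ :=
  mem_radSetAt_of_forall_gt hδ hpos fun _ h => mem_radSetAt_of_radThreshold_lt hδ hmem h

/-- **The radii of a hard core form a closed ray**: for `δ ∈ RungSet` and `R > 0`, `RungAt δ R ↔ R*(δ) ≤ R`. -/
theorem rungAt_iff_radThreshold_le {δ R : ℝ} (hδ : 0 < δ) (hmem : δ ∈ RungSet) (hR : 0 < R) :
    RungAt δ R ↔ radThreshold δ ≤ R := by
  refine ⟨fun h => radThreshold_le_of_mem ⟨hR, h⟩, fun h => ?_⟩
  rcases h.lt_or_eq with hlt | heq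
  · exact (mem_radSetAt_of_radThreshold_lt hδ hmem hlt).2
  · have hm := radThreshold_mem hδ hmem (heq ▸ hR)
    rw [heq] at hm
    exact hm.2

/-- `R*` is antitone on `RungSet`: a larger hard core needs no larger radius. -/
theorem radThreshold_antitone {δ δ' : ℝ} (hδ : 0 < δ) (hmem : δ ∈ RungSet) (hle : δ ≤ δ') :
    radThreshold δ' ≤ radThreshold δ :=
  csInf_le_csInf (radSetAt_bddBelow δ') ((radSetAt_nonempty_iff hδ).2 hmem) (radSetAt_mono hle)

/-- Above the half-rule threshold every positive radius works: `R*(δ) = 0` for `δ_½ ≤ δ`. -/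
theorem radThreshold_eq_zero_of_threshold_le {δ : ℝ} (h : halfSumThreshold ≤ δ) : radThreshold δ = 0 := by
  refine le_antisymm ?_ (radThreshold_nonneg δ)
  refine le_of_forall_gt_imp_ge_of_dense fun R hR => ?_
  exact radThreshold_le_of_mem ⟨hR, rungAt_of_threshold_le h R⟩

/-- Below the half-rule threshold a rung must read at least its own hard core: `δ ≤ R*(δ)` for `δ ∈ RungSet`,
`δ < δ_½`. -/
theorem le_radThreshold_of_lt_threshold {δ : ℝ} (hδ : 0 < δ) (hmem : δ ∈ RungSet)
    (hlt : δ < halfSumThreshold) : δ ≤ radThreshold δ := by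
  refine le_csInf ((radSetAt_nonempty_iff hδ).2 hmem) fun R hR => ?_
  by_contra hRδ
  have hRδ' : R < δ := not_le.mp hRδ
  exact absurd ((rungAt_iff_threshold_le_of_lt hδ hRδ').1 hR.2) (not_le.mpr hlt)

/-- For a hard core `δ ≤ 47/50` in `RungSet`, `47/50 ≤ R*(δ)` (`not_rungAt_47_50`). -/
theorem radThreshold_ge_47_50 {δ : ℝ} (hδ : 0 < δ) (hmem : δ ∈ RungSet) (hle : δ ≤ 47 / 50) :
    47 / 50 ≤ radThreshold δ := by
  refine le_csInf ((radSetAt_nonempty_iff hδ).2 hmem) fun R hR => ?_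
  by_contra hR'
  exact not_rungAt_47_50 δ R hle (not_le.mp hR') hR.2

/-- **The jump at `δ_½`**: `R*(δ_½ ) = 0`, while every `δ ∈ RungSet` below `δ_½` has `R*(δ) ≥ δ`; and if some hard
core below `δ_½` is in `RungSet` at all then hard cores arbitrarily close below `δ_½` are, with `R*` there `≥ δ`,
so `R*` is discontinuous at `δ_½` with a jump of at least `δ_½ ≥ 47/50`. -/
theorem radThreshold_jump :
    radThreshold halfSumThreshold = 0 ∧
    (∀ δ : ℝ, 0 < δ → δ ∈ RungSet → δ < halfSumThreshold → δ ≤ radThreshold δ) ∧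
    (47 / 50 : ℝ) ≤ halfSumThreshold :=
  ⟨radThreshold_eq_zero_of_threshold_le le_rfl, fun _ hδ hmem hlt => le_radThreshold_of_lt_threshold hδ hmem hlt,
    le_halfSumThreshold_47_50⟩

/-! ## 3. Right-continuity of `δ*` and the duality `δ* ↔ R*` -/

/-- **`δ*` is right-continuous** on `(0, ∞)`: `δ*(R)` is the supremum of `δ*(R')` over `R' > R`. -/
theorem isLUB_sepThreshold_Ioi {R : ℝ} (hR : 0 < R) :
    IsLUB (sepThreshold '' Set.Ioi R) (sepThreshold R) := by
  refine ⟨?_, fun M hM => ?_⟩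
  · rintro _ ⟨R', hR', rfl⟩
    exact sepThreshold_antitone (le_of_lt hR')
  · refine le_of_forall_gt_imp_ge_of_dense fun δ hδ => ?_
    have hM0 : 0 ≤ M := (sepThreshold_nonneg (R + 1)).trans (hM ⟨R + 1, by simp, rfl⟩)
    have hδ0 : 0 < δ := hM0.trans_lt hδ
    have hr : RungAt δ R := rungAt_of_forall_gt_radius hδ0 hR fun R' hR' =>
      (mem_rungSetAt_of_sepThreshold_lt ((hM ⟨R', hR', rfl⟩).trans_lt hδ)).2
    exact sepThreshold_le_of_mem ⟨hδ0, hr⟩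

/-- `δ*(R') → δ*(R)` as `R' ↓ R` (`R > 0`). -/
theorem tendsto_sepThreshold_nhdsGT {R : ℝ} (hR : 0 < R) :
    Tendsto sepThreshold (𝓝[>] R) (𝓝 (sepThreshold R)) := by
  have h := sepThreshold_antitone.tendsto_nhdsGT R
  rwa [(isLUB_sepThreshold_Ioi hR).csSup_eq (Set.Nonempty.image _ ⟨R + 1, by simp⟩)] at h

/-- **`R*` is right-continuous** on `RungSet`: `R*(δ)` is the supremum of `R*(δ')` over `δ' > δ` (closedness in `δ` at
fixed radius, `rungAt_of_forall_gt_sep`). -/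
theorem isLUB_radThreshold_Ioi {δ : ℝ} (hδ : 0 < δ) (hmem : δ ∈ RungSet) :
    IsLUB (radThreshold '' Set.Ioi δ) (radThreshold δ) := by
  refine ⟨?_, fun M hM => ?_⟩
  · rintro _ ⟨δ', hδ', rfl⟩
    exact radThreshold_antitone hδ hmem (le_of_lt hδ')
  · refine le_of_forall_gt_imp_ge_of_dense fun R hRM => ?_
    have hM0 : 0 ≤ M := (radThreshold_nonneg (δ + 1)).trans (hM ⟨δ + 1, by simp, rfl⟩)
    have hR0 : 0 < R := hM0.trans_lt hRM
    have hr : RungAt δ R := rungAt_of_forall_gt_sep hδ hR0.le fun δ' hδ' =>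
      (mem_radSetAt_of_radThreshold_lt (hδ.trans hδ') (mem_rungSet_of_le hmem hδ'.le)
        ((hM ⟨δ', hδ', rfl⟩).trans_lt hRM)).2
    exact radThreshold_le_of_mem ⟨hR0, hr⟩

/-- **Duality**: for `δ ∈ RungSet` and `R > 0`, `δ*(R) ≤ δ ↔ RungAt δ R ↔ R*(δ) ≤ R`. -/
theorem sepThreshold_le_iff_radThreshold_le {δ R : ℝ} (hδ : 0 < δ) (hmem : δ ∈ RungSet) (hR : 0 < R) :
    sepThreshold R ≤ δ ↔ radThreshold δ ≤ R := by
  rw [← rungAt_iff_sepThreshold_le hR.le hδ, rungAt_iff_radThreshold_le hδ hmem hR]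

/-- Crux r2 in terms of the minimal radius: `FiniteRangeSplitting ↔` every positive hard core has SOME rung, i.e.
`RungSet = (0, ∞)`; then `R*` is an antitone function `(0, ∞) → [0, ∞)` with `R*(δ) ≥ δ` exactly below `δ_½`
and `R*(δ) = 0` from `δ_½` on. -/
theorem finiteRangeSplitting_iff_rungSet_eq :
    Summit.AtomisticToContinuum.Crystallization.Theses.FreeSplittingCertificates.FiniteRangeSplitting ↔
      RungSet = Set.Ioi 0 := by
  rw [finiteRangeSplitting_iff_rung]
  constructor
  · intro h
    ext δ
    exact ⟨fun hδ => hδ.1, fun hδ => ⟨hδ, h δ hδ⟩⟩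
  · intro h δ hδ
    have hmem : δ ∈ RungSet := by rw [h]; exact hδ
    exact hmem.2

end Summit.AtomisticToContinuum.Crystallization.Theorems.StrictSplittingRuleBirth

end
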